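import Summits.Parity.GeneralizedHardyLittlewood.Theorems.GoldbachHeathBrownDispersionHeathBrownMorozUniformClassDisplay104Pairs
import Literature.NumberTheory.Sieve.HeathBrownMorozResidueClassesSieve
import HarnessLib

/-!
# Crux `HeathBrownMorozUniform` (stmt-Parity-19915), line `parent-differencing`, stub `stub_classDisplay104`, II:
# `U_e(𝒜_cl)`, `U₁(𝒜_cl)` as class pair sums, Lemma 3.2 on them, and the class Type-I total

Helper file (`--supports stmt-Parity-19915`): the class twin of `Literature/…/HeathBrownCubicLeadingA.lean`
(`U1_eq_pairs`, `abs_Ue_sub_U1_le`, `abs_U1_sub_U2_le`, `typeI_total_le`, `assembly_abs_le`, `display_10_4_core`)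
for the residue-class subfamily `classPairs X η d a b` (Heath-Brown–Moroz 2004, Lemma 4.1), proving

  `|U_e(𝒜_cl; 𝐦, c) − (w(d)/d²)·σ₀η²X²Σ₃(𝐦, c)| ≤ C(d, σ₀, …)·M⁻¹η^{5/2}X²(log X)²`

at one point `(X, η, 𝐦, c_R)` of the standing set-up, from two HYPOTHESES: the class Type-I square-free sum
(shape of the skeleton's `ClassTypeISqfreeSum`, PROVED there from the landed `class_typeI_A`) and the
coprime-restricted singular sum `Σ₁^{(d)}` (shape of the skeleton's `ClassSigmaOneCoprime`). The error of
(10.1)–(10.2) is bounded by the PARENT's (`classCountA ≤ countA`, parent Type I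
`exists_typeI_squarefree_sum_le`); `Σ'`, `ρ₂(R) = 1 + O(τ⁻¹X^{−τ})`, `Σ₃` and all numerics are the parent's lemmas
verbatim; `(d, N R) = 1` on the support of `c_R` because `X^τ > d`; the main-term constant is
`X_cl·(π²/6)σ₀·coprimeClassWeight d = (w(d)/d²)σ₀η²X²` (`coprimeClassWeight_mul_zetaTwoCorrection`).

**Goldbach is not proved here** (FRONTIER formalisation rung `GoldbachHeathBrownDispersion` only).

References: [cite: HeathBrownActa2001, §10 (10.1)–(10.4)]; [cite: HeathBrownMoroz2004, Lemma 4.1 and (3.1)].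
Tree: `HeathBrownCubicLeadingA` (all of it), `HeathBrownCubicLeadingAPairs` (`bilin_sum_divisors_eq`,
`sum_pairs_countA_le`), `…ClassDisplay104Pairs` (`abs_sum_pairs_classCountA_sub_le`,
`sum_pairs_classCountA_le_countA`, `coprime_absNorm_of_rough_of_lt`), `HeathBrownMorozClassFLSequences`
(`classSizeA`), `HeathBrownMorozResidueClassesSieve` (`coprimeClassWeight_mul_zetaTwoCorrection`).
-/

noncomputable section

open Polynomial NumberField Finset Filter Topology

namespace Summit.Parity.GeneralizedHardyLittlewood.Theorems.GoldbachHeathBrownDispersionHeathBrownMorozUniform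

open Literature.NumberTheory.Sieve.CubicSieve Literature.NumberTheory.Sieve.CubicPrimes
open Literature.NumberTheory.LFunctions.CubeRootTwoField

/-! ### `U_e(𝒜_cl)` and `U₁(𝒜_cl) = ∑_{R,J} c_{R,J} #𝒜_{cl,RJ}` -/

section PairForms

variable {X η τ : ℝ} {d a b : ℕ}

open scoped Classical in
/-- **`U₁(𝒜_cl) = ∑_{R,J} c_{R,J} #𝒜_{cl,RJ}`** (class twin of `U1_eq_pairs`; exchange of summations
`bilin_sum_divisors_eq` over the class family, whose members lie in the box: `N ≤ 24X³`).
[cite: HeathBrownMoroz2004, Lemma 4.1] [cite: HeathBrownActa2001, §10 p. 62] -/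
theorem classU1_eq_pairs (hX : 0 < X) (hη1 : η ≤ 1) {k : ℕ} (m : Fin k → ℕ) (cR : Ideal (𝓞 K) → ℝ) (L : ℝ) :
    ∑ xy ∈ classPairs X η d a b, ∑ RS ∈ divisorPairs (pairIdeal xy), cR RS.1 *
        (wDeriv X τ m (3 * X ^ 3 / Ideal.absNorm RS.1) / (∏ i, ((m i : ℝ) * hbXi τ * Real.log X)) *
          ∑ J ∈ (idealDivisors RS.2).filter (fun J => (Ideal.absNorm J : ℝ) < L),
            idealMoebius J * Real.log (L / Ideal.absNorm J)) =
      ∑ R ∈ idealsLE ⌊24 * X ^ 3⌋₊, ∑ J ∈ (idealsLE ⌊L⌋₊).filter (fun J => (Ideal.absNorm J : ℝ) < L),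
        (cR R * wDeriv X τ m (3 * X ^ 3 / Ideal.absNorm R) / (∏ i, ((m i : ℝ) * hbXi τ * Real.log X))) *
          (idealMoebius J * Real.log (L / Ideal.absNorm J)) * (classCountA X η d a b (R * J) : ℝ) := by
  have hsub := classPairs_subset_boxPairs X η d a b
  have hI : ∀ xy ∈ classPairs X η d a b, pairIdeal xy ≠ ⊥ := fun xy hxy =>
    pairIdeal_ne_bot_of_mem_boxPairs hX.le xy (hsub hxy)
  have hN : ∀ xy ∈ classPairs X η d a b, Ideal.absNorm (pairIdeal xy) ≤ ⌊24 * X ^ 3⌋₊ := fun xy hxy =>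
    Nat.le_floor (absNorm_pairIdeal_bounds hX hη1 (hsub hxy)).2
  have h := bilin_sum_divisors_eq (classPairs X η d a b) pairIdeal hI
    (fun R => cR R * wDeriv X τ m (3 * X ^ 3 / Ideal.absNorm R) / ∏ i, ((m i : ℝ) * hbXi τ * Real.log X))
    (fun J => idealMoebius J * Real.log (L / Ideal.absNorm J)) L hN
  simp only [card_filter_dvd_eq_classCountA] at h
  rw [← h]
  refine sum_congr rfl fun xy _ => sum_congr rfl fun RS _ => ?_
  ring

open scoped Classical in
/-- **The error of replacing `w'(N(S))` by `w'(3X³/N(R))` in `U_e(𝒜_cl)`, as a class pair sum** ((10.1)–(10.2)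
for the class; twin of `abs_Ue_sub_U1_le`): if `|w'(N(S)) − w'(3X³/N(R))| ≤ δ_R` whenever `RS ∈ 𝒜_cl`, then
`|U_e(𝒜_cl) − U₁(𝒜_cl)| ≤ ∑_{R,J} (|c_R|δ_R/∏(m_iξ log X)) (|μ(J)| log L) #𝒜_{cl,RJ}`.
[cite: HeathBrownMoroz2004, Lemma 4.1] [cite: HeathBrownActa2001, §10 (10.1)–(10.2)] -/
theorem abs_classUe_sub_U1_le (hX : 0 < X) (hη1 : η ≤ 1) {L : ℝ} (hL : 1 ≤ L) {k : ℕ} (m : Fin k → ℕ)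
    (cR δ : Ideal (𝓞 K) → ℝ) (hD : 0 < ∏ i, ((m i : ℝ) * hbXi τ * Real.log X))
    (hδ : ∀ xy ∈ classPairs X η d a b, ∀ RS ∈ divisorPairs (pairIdeal xy),
      |wDeriv X τ m (Ideal.absNorm RS.2) - wDeriv X τ m (3 * X ^ 3 / Ideal.absNorm RS.1)| ≤ δ RS.1) :
    |(∑ xy ∈ classPairs X η d a b, ∑ RS ∈ divisorPairs (pairIdeal xy), cR RS.1 *
        (wDeriv X τ m (Ideal.absNorm RS.2) / (∏ i, ((m i : ℝ) * hbXi τ * Real.log X)) *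
          ∑ J ∈ (idealDivisors RS.2).filter (fun J => (Ideal.absNorm J : ℝ) < L),
            idealMoebius J * Real.log (L / Ideal.absNorm J))) -
      ∑ xy ∈ classPairs X η d a b, ∑ RS ∈ divisorPairs (pairIdeal xy), cR RS.1 *
        (wDeriv X τ m (3 * X ^ 3 / Ideal.absNorm RS.1) / (∏ i, ((m i : ℝ) * hbXi τ * Real.log X)) *
          ∑ J ∈ (idealDivisors RS.2).filter (fun J => (Ideal.absNorm J : ℝ) < L),
            idealMoebius J * Real.log (L / Ideal.absNorm J))| ≤
      ∑ R ∈ idealsLE ⌊24 * X ^ 3⌋₊, ∑ J ∈ (idealsLE ⌊L⌋₊).filter (fun J => (Ideal.absNorm J : ℝ) < L),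
        (|cR R| * δ R / ∏ i, ((m i : ℝ) * hbXi τ * Real.log X)) * (|idealMoebius J| * Real.log L) *
          (classCountA X η d a b (R * J) : ℝ) := by
  set D : ℝ := ∏ i, ((m i : ℝ) * hbXi τ * Real.log X) with hDdef
  have hsub := classPairs_subset_boxPairs X η d a b
  have hI : ∀ xy ∈ classPairs X η d a b, pairIdeal xy ≠ ⊥ := fun xy hxy =>
    pairIdeal_ne_bot_of_mem_boxPairs hX.le xy (hsub hxy)
  have hN : ∀ xy ∈ classPairs X η d a b, Ideal.absNorm (pairIdeal xy) ≤ ⌊24 * X ^ 3⌋₊ := fun xy hxy =>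
    Nat.le_floor (absNorm_pairIdeal_bounds hX hη1 (hsub hxy)).2
  have h := bilin_sum_divisors_eq (classPairs X η d a b) pairIdeal hI (fun R => |cR R| * δ R / D)
    (fun J => |idealMoebius J| * Real.log L) L hN
  simp only [card_filter_dvd_eq_classCountA] at h
  rw [← h, ← sum_sub_distrib]
  refine (abs_sum_le_sum_abs _ _).trans (sum_le_sum fun xy hxy => ?_)
  rw [← sum_sub_distrib]
  refine (abs_sum_le_sum_abs _ _).trans (sum_le_sum fun RS hRS => ?_)
  have hI0 := hI xy hxy
  have hRSI := (mem_divisorPairs_iff hI0).mp hRS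
  have hS0 : RS.2 ≠ ⊥ := fun h0 => hI0 (by rw [← hRSI, h0, Ideal.mul_bot])
  have hΛ := abs_moebiusSum_le hS0 hL
  have hw := hδ xy hxy RS hRS
  set Λs := ∑ J ∈ (idealDivisors RS.2).filter (fun J => (Ideal.absNorm J : ℝ) < L),
    idealMoebius J * Real.log (L / Ideal.absNorm J) with hΛs
  set Λa := ∑ J ∈ (idealDivisors RS.2).filter (fun J => (Ideal.absNorm J : ℝ) < L),
    |idealMoebius J| * Real.log L with hΛa
  rw [show cR RS.1 * (wDeriv X τ m (Ideal.absNorm RS.2) / D * Λs) -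
      cR RS.1 * (wDeriv X τ m (3 * X ^ 3 / Ideal.absNorm RS.1) / D * Λs) =
      cR RS.1 * ((wDeriv X τ m (Ideal.absNorm RS.2) - wDeriv X τ m (3 * X ^ 3 / Ideal.absNorm RS.1)) / D) * Λs
      by ring, abs_mul, abs_mul, abs_div, abs_of_pos hD]
  have h0 : 0 ≤ Λa := sum_nonneg fun J _ => mul_nonneg (abs_nonneg _) (Real.log_nonneg hL)
  calc |cR RS.1| * (|wDeriv X τ m (Ideal.absNorm RS.2) - wDeriv X τ m (3 * X ^ 3 / Ideal.absNorm RS.1)| / D) * |Λs|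
      ≤ |cR RS.1| * (δ RS.1 / D) * Λa := by
        refine mul_le_mul (mul_le_mul_of_nonneg_left (div_le_div_of_nonneg_right hw hD.le) (abs_nonneg _))
          hΛ (abs_nonneg _) ?_
        exact mul_nonneg (abs_nonneg _) (div_nonneg ((abs_nonneg _).trans hw) hD.le)
    _ = |cR RS.1| * δ RS.1 / D * Λa := by ring

end PairForms

/-! ### `U₁(𝒜_cl) − U₂(𝒜_cl)`: Lemma 3.2 on the class pair sum -/

section EtwoBound

variable {X η τ : ℝ} {d a b : ℕ}

open scoped Classical in
/-- **Lemma 3.2 applied to `U₁(𝒜_cl)`** (class twin of `abs_U1_sub_U2_le`): for `𝐦` of length `n + 1`,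
`0 < d < X^τ` (so that `(d, N R) = 1` on the support of `c_R`, which lives on `X^τ`-rough `R ∈ 𝒯r`),
`|U₁(𝒜_cl) − X_cl (∑_R α_Rρ₂(R)/N(R)) Σ₁^{(d)}(L)| ≤ ((ξ log X)^n/∏)·log L·∑_{N(D) ≤ 24X^{2−τ}L, D∈𝒯r}|#𝒜_{cl,D} − main_cl(D)|`,
`α_R = c_R w'(3X³/N(R))/∏(m_iξ log X)`, `Σ₁^{(d)}(L) = ∑_{N J < L, J ∈ 𝒯r, (d, N J) = 1} μ(J)log(L/N J)ρ₂(J)/N(J)`.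
[cite: HeathBrownMoroz2004, Lemma 4.1] [cite: HeathBrownActa2001, §10 p. 62] -/
theorem abs_classU1_sub_U2_le (hX : 1 < X) (hτ : 0 < τ) (hτ1 : τ ≤ 1) (hd : 0 < d) (hdτ : (d : ℝ) < X ^ τ)
    {n : ℕ} {m : Fin (n + 1) → ℕ} (hm : CoreAdmissible τ m) {cR : Ideal (𝓞 K) → ℝ} (hc : CSupport X τ cR) :
    |∑ R ∈ idealsLE ⌊24 * X ^ 3⌋₊,
        ∑ J ∈ (idealsLE ⌊hbL X τ⌋₊).filter (fun J => (Ideal.absNorm J : ℝ) < hbL X τ),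
          (cR R * wDeriv X τ m (3 * X ^ 3 / Ideal.absNorm R) / ∏ i, ((m i : ℝ) * hbXi τ * Real.log X)) *
            (idealMoebius J * Real.log (hbL X τ / Ideal.absNorm J)) * (classCountA X η d a b (R * J) : ℝ) -
      classSizeA X η d *
        (∑ R ∈ idealsLE ⌊24 * X ^ 3⌋₊,
          (cR R * wDeriv X τ m (3 * X ^ 3 / Ideal.absNorm R) / ∏ i, ((m i : ℝ) * hbXi τ * Real.log X)) *
            (rho₂ R / Ideal.absNorm R)) *
        ∑ J ∈ ((idealsLE ⌊hbL X τ⌋₊).filter (fun J => (Ideal.absNorm J : ℝ) < hbL X τ)).filter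
          (fun J => Squarefree (Ideal.absNorm J) ∧ Nat.Coprime d (Ideal.absNorm J)),
          (idealMoebius J * Real.log (hbL X τ / Ideal.absNorm J)) * (rho₂ J / Ideal.absNorm J)| ≤
      ((hbXi τ * Real.log X) ^ n / ∏ i, ((m i : ℝ) * hbXi τ * Real.log X)) * Real.log (hbL X τ) *
        ∑ D ∈ (idealsLE ⌊24 * X ^ (2 - τ) * hbL X τ⌋₊).filter (fun D => Squarefree (Ideal.absNorm D)),
          |(classCountA X η d a b D : ℝ) -
            (if Nat.Coprime d (Ideal.absNorm D) then classSizeA X η d * rho₂ D / Ideal.absNorm D else 0)| := by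
  have hX0 : 0 < X := by linarith
  obtain ⟨hL1, hLz, -⟩ := hbL_facts hX.le hτ.le
  obtain ⟨hΛ, -, -, hD⟩ := prodWeight_pos hX hτ hτ1 hm
  refine abs_sum_pairs_classCountA_sub_le (z := X ^ τ) hX0.le hLz (by positivity) _ _ _
    (fun R _ h => ?_) (fun R _ => abs_alpha_le hX hτ hτ1 hm hc R)
    (fun J h => squarefree_of_idealMoebius_ne_zero fun h0 => h (by rw [h0, zero_mul]))
    (fun J hJ => abs_beta_le hL1 (mem_filter.mp hJ).2) (by positivity) (Real.log_nonneg hL1)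
  obtain ⟨hsq, hrough, hN⟩ := alpha_support hX hτ hm hc (R := R) (fun h0 => h (by rw [h0, zero_div]))
  exact ⟨hsq, hrough, hN.trans (by nlinarith [Real.rpow_nonneg hX0.le (2 - τ)]),
    coprime_absNorm_of_rough_of_lt hsq hrough hd hdτ⟩

/-- `ζ(2)/ζ_d(2) ≤ d²` for `d ≥ 1` (each factor `(1 − p⁻²)⁻¹ = p²/(p²−1) ≤ p`, and `∏_{p∣d} p ≤ d ≤ d²`).
[cite: HeathBrownMoroz2004, Lemma 2.4] -/
theorem zetaTwoCorrection_le_sq (hd : 0 < d) : zetaTwoCorrection d ≤ (d : ℝ) ^ 2 := by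
  rw [zetaTwoCorrection_def]
  have hfac : ∀ p ∈ d.primeFactors, (1 - ((p : ℝ) ^ 2)⁻¹)⁻¹ ≤ (p : ℝ) := by
    intro p hp
    have hp2 : (2 : ℝ) ≤ p := by exact_mod_cast (Nat.prime_of_mem_primeFactors hp).two_le
    have hp0 : (0 : ℝ) < (p : ℝ) ^ 2 - 1 := by nlinarith
    have heq : (1 - ((p : ℝ) ^ 2)⁻¹)⁻¹ = (p : ℝ) ^ 2 / ((p : ℝ) ^ 2 - 1) := by
      have : (p : ℝ) ^ 2 ≠ 0 := by positivity
      field_simp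
    rw [heq, div_le_iff₀ hp0]
    nlinarith
  have hpos : ∀ p ∈ d.primeFactors, 0 ≤ (1 - ((p : ℝ) ^ 2)⁻¹)⁻¹ := by
    intro p hp
    have hp2 : (2 : ℝ) ≤ p := by exact_mod_cast (Nat.prime_of_mem_primeFactors hp).two_le
    have h4 : ((p : ℝ) ^ 2)⁻¹ ≤ 4⁻¹ := inv_anti₀ (by norm_num) (by nlinarith)
    have : 0 < 1 - ((p : ℝ) ^ 2)⁻¹ := by linarith [show (4:ℝ)⁻¹ < 1 by norm_num]
    positivity
  have hd1 : (1 : ℝ) ≤ d := by exact_mod_cast hd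
  calc ∏ p ∈ d.primeFactors, (1 - ((p : ℝ) ^ 2)⁻¹)⁻¹ ≤ ∏ p ∈ d.primeFactors, (p : ℝ) :=
        prod_le_prod hpos hfac
    _ = ((∏ p ∈ d.primeFactors, p : ℕ) : ℝ) := by push_cast; rfl
    _ ≤ d := by exact_mod_cast Nat.le_of_dvd hd (Nat.prod_primeFactors_dvd d)
    _ ≤ (d : ℝ) ^ 2 := by nlinarith

/-- `X_cl ≤ η²X²` for `d ≥ 1` (`X_cl = (6η²X²/π²)(ζ(2)/ζ_d(2))d⁻²`, `ζ(2)/ζ_d(2) ≤ d²`, `π² ≥ 6`).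
[cite: HeathBrownMoroz2004, Lemma 2.4 (2.29)] -/
theorem classSizeA_le (hd : 0 < d) : classSizeA X η d ≤ η ^ 2 * X ^ 2 := by
  have hd0 : (0 : ℝ) < (d : ℝ) ^ 2 := by positivity
  have hζ := zetaTwoCorrection_le_sq hd
  have hζ0 := (zetaTwoCorrection_pos d).le
  have hπ3 := Real.pi_gt_three
  have hπ : (6 : ℝ) ≤ Real.pi ^ 2 := by nlinarith
  have hπ0 : (0 : ℝ) < Real.pi ^ 2 := by positivity
  have h0 : 0 ≤ η ^ 2 * X ^ 2 := by positivity
  rw [classSizeA, div_le_iff₀ hd0]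
  calc 6 * η ^ 2 * X ^ 2 / Real.pi ^ 2 * zetaTwoCorrection d
      ≤ 6 * η ^ 2 * X ^ 2 / Real.pi ^ 2 * (d : ℝ) ^ 2 :=
        mul_le_mul_of_nonneg_left hζ (by positivity)
    _ = (η ^ 2 * X ^ 2 * (d : ℝ) ^ 2) * (6 / Real.pi ^ 2) := by ring
    _ ≤ (η ^ 2 * X ^ 2 * (d : ℝ) ^ 2) * 1 := by
        refine mul_le_mul_of_nonneg_left ?_ (by positivity)
        rw [div_le_one hπ0]; exact hπ
    _ = η ^ 2 * X ^ 2 * (d : ℝ) ^ 2 := mul_one _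

open scoped Classical in
/-- **The size of the total class Type-I error in (10.4)** (class twin of `typeI_total_le`): from the class
Type-I square-free sum (the skeleton's `ClassTypeISqfreeSum`, main term VERBATIM that of `class_typeI_A`), for
`X ≥ 4(d+2)²`, `0 < τ ≤ 1`, `η` in the range (2.1):
`∑_{N(D) ≤ 24X^{2−τ}L, D ∈ 𝒯r} |#𝒜_{cl,D} − main_cl(D)| ≤ 32C₂ X^{2−τ/4}(log X)^{k₂+1}`.
[cite: HeathBrownMoroz2004, Lemma 2.4 (2.29)] [cite: HeathBrownActa2001, §10 p. 62] -/
theorem class_typeI_total_le {C₂ : ℝ} {k₂ : ℕ} (hC₂ : 0 ≤ C₂)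
    (hTI : ∀ X η B : ℝ, 4 * ((d : ℝ) + 2) ^ 2 ≤ X →
      Real.exp (-Real.log X ^ (1 / 3 : ℝ)) ≤ η → η ≤ 1 → 1 ≤ B → B ≤ X ^ 3 →
        ∑ D ∈ (idealsLE ⌊B⌋₊).filter (fun D => Squarefree (Ideal.absNorm D)),
            |(classCountA X η d a b D : ℝ) -
              (if Nat.Coprime d (Ideal.absNorm D) then
                6 * η ^ 2 * X ^ 2 / Real.pi ^ 2 * zetaTwoCorrection d / (d : ℝ) ^ 2 * rho₂ D /
                  Ideal.absNorm D else 0)| ≤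
          C₂ * (X * (1 + Real.log X) + (B + X * Real.sqrt B + X ^ (3 / 2 : ℝ)) * Real.log X ^ (k₂ + 1)))
    (hX : 4 * ((d : ℝ) + 2) ^ 2 ≤ X) (hX24 : 24 ≤ X) (hτ : 0 < τ) (hτ1 : τ ≤ 1)
    (hηlo : Real.exp (-Real.log X ^ (1 / 3 : ℝ)) ≤ η) (hη1 : η ≤ 1) :
    ∑ D ∈ (idealsLE ⌊24 * X ^ (2 - τ) * hbL X τ⌋₊).filter (fun D => Squarefree (Ideal.absNorm D)),
        |(classCountA X η d a b D : ℝ) -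
          (if Nat.Coprime d (Ideal.absNorm D) then classSizeA X η d * rho₂ D / Ideal.absNorm D else 0)| ≤
      32 * C₂ * X ^ (2 - τ / 4) * Real.log X ^ (k₂ + 1) := by
  have hX0 : 0 < X := by linarith
  have hX1 : 1 ≤ X := by linarith
  set B : ℝ := 24 * X ^ (2 - τ) * hbL X τ with hB
  have hBeq : B = 24 * X ^ (2 - τ / 2) := by
    rw [hB, hbL, mul_assoc, ← Real.rpow_add hX0]; ring_nf
  have hpow1 : X ^ (2 - τ / 2) ≤ X ^ (2 - τ / 4) := Real.rpow_le_rpow_of_exponent_le hX1 (by linarith)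
  have hpow2 : X ^ (3 / 2 : ℝ) ≤ X ^ (2 - τ / 4) := Real.rpow_le_rpow_of_exponent_le hX1 (by linarith)
  have hpow3 : X ≤ X ^ (2 - τ / 4) := by
    conv_lhs => rw [← Real.rpow_one X]
    exact Real.rpow_le_rpow_of_exponent_le hX1 (by linarith)
  have hpow4 : (1 : ℝ) ≤ X ^ (2 - τ / 2) := Real.one_le_rpow hX1 (by linarith)
  have hB1 : 1 ≤ B := by rw [hBeq]; nlinarith
  have hBX : B ≤ X ^ 3 := by
    rw [hBeq]
    calc 24 * X ^ (2 - τ / 2) ≤ X * X ^ (2 : ℝ) := by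
          refine mul_le_mul hX24 (Real.rpow_le_rpow_of_exponent_le hX1 (by linarith)) (by positivity) hX0.le
      _ = X ^ 3 := by rw [Real.rpow_two]; ring
  have h := hTI X η B hX hηlo hη1 hB1 hBX
  have hcl : ∀ D : Ideal (𝓞 K), classSizeA X η d * rho₂ D / Ideal.absNorm D =
      6 * η ^ 2 * X ^ 2 / Real.pi ^ 2 * zetaTwoCorrection d / (d : ℝ) ^ 2 * rho₂ D / Ideal.absNorm D :=
    fun D => by rw [classSizeA]
  simp only [hcl]
  refine h.trans ?_
  have hlog1 : 1 ≤ Real.log X := by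
    rw [← Real.log_exp 1]
    exact Real.log_le_log (Real.exp_pos 1) (by have := Real.exp_one_lt_d9; linarith)
  have hlogk : Real.log X ≤ Real.log X ^ (k₂ + 1) := by
    calc Real.log X = Real.log X ^ 1 := (pow_one _).symm
      _ ≤ Real.log X ^ (k₂ + 1) := pow_le_pow_right₀ hlog1 (by omega)
  have hsqrtB : Real.sqrt B ≤ 5 * X ^ (1 - τ / 4) := by
    rw [hBeq, Real.sqrt_le_left (by positivity)]
    have : (5 * X ^ (1 - τ / 4)) ^ 2 = 25 * X ^ (2 - τ / 2) := by
      rw [mul_pow, ← Real.rpow_natCast (X ^ (1 - τ / 4)) 2, ← Real.rpow_mul hX0.le]; norm_num; ring_nf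
    rw [this]; nlinarith
  have hXsqrt : X * Real.sqrt B ≤ 5 * X ^ (2 - τ / 4) := by
    calc X * Real.sqrt B ≤ X * (5 * X ^ (1 - τ / 4)) := mul_le_mul_of_nonneg_left hsqrtB hX0.le
      _ = 5 * (X ^ (1 : ℝ) * X ^ (1 - τ / 4)) := by rw [Real.rpow_one]; ring
      _ = 5 * X ^ (2 - τ / 4) := by rw [← Real.rpow_add hX0]; ring_nf
  set P := X ^ (2 - τ / 4) with hP
  have hP0 : 0 ≤ P := Real.rpow_nonneg hX0.le _
  set ℓ := Real.log X with hℓ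
  have hℓk0 : 0 ≤ ℓ ^ (k₂ + 1) := pow_nonneg (by linarith) _
  have h1 : X * (1 + ℓ) ≤ 2 * P * ℓ ^ (k₂ + 1) := by
    have : 1 + ℓ ≤ 2 * ℓ ^ (k₂ + 1) := by linarith
    calc X * (1 + ℓ) ≤ P * (2 * ℓ ^ (k₂ + 1)) := mul_le_mul hpow3 this (by linarith) hP0
      _ = 2 * P * ℓ ^ (k₂ + 1) := by ring
  have h2 : (B + X * Real.sqrt B + X ^ (3 / 2 : ℝ)) * ℓ ^ (k₂ + 1) ≤ 30 * P * ℓ ^ (k₂ + 1) := by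
    refine mul_le_mul_of_nonneg_right ?_ hℓk0
    have : B ≤ 24 * P := by rw [hBeq]; linarith
    linarith
  calc C₂ * (X * (1 + ℓ) + (B + X * Real.sqrt B + X ^ (3 / 2 : ℝ)) * ℓ ^ (k₂ + 1))
      ≤ C₂ * (2 * P * ℓ ^ (k₂ + 1) + 30 * P * ℓ ^ (k₂ + 1)) := mul_le_mul_of_nonneg_left (add_le_add h1 h2) hC₂
    _ = 32 * C₂ * P * ℓ ^ (k₂ + 1) := by ring

end EtwoBound

end Summit.Parity.GeneralizedHardyLittlewood.Theorems.GoldbachHeathBrownDispersionHeathBrownMorozUniform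

end
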